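import Literature.NumberTheory.EllipticCurves.FormalGroupFrobeniusTypeProofs
import Literature.NumberTheory.EllipticCurves.PadicSigmaVariableChangeProofs
import Literature.NumberTheory.EllipticCurves.OrdinaryPrimesProofs
import Literature.NumberTheory.EllipticCurves.GlobalMinimalModel
import Literature.NumberTheory.EllipticCurves.GlobalMinimalModelProofs
import Literature.NumberTheory.EllipticCurves.ModularParamFormalLogProofs
import Literature.NumberTheory.EllipticCurves.ModularParamIntegralityProofs
import Literature.NumberTheory.EllipticCurves.FormalLogExpBaseChangeProofs
import Literature.NumberTheory.EllipticCurves.ModularityVersionAp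
import Literature.NumberTheory.EllipticCurves.ModularSymbolsLattice
import Literature.NumberTheory.EllipticCurves.LFunctionPrimeCoeff
import Literature.NumberTheory.EllipticCurves.LFunctionSmulProofs
import Literature.NumberTheory.EllipticCurves.EichlerShimuraConstructionCongruenceProofs
import Mathlib.RingTheory.PowerSeries.Order
import HarnessLib

/-!
# The Eichler–Shimura congruence for `E_f = ℂ/Λ_f` by Honda's method, and
# `eichlerShimuraConstruction` modulo modularity (Knapp Thm. 11.74 / Shimura Thm. 7.14–7.15; proofs only)

Trunk T-NT-EC (Literature/NumberTheory/EllipticCurves). Pure proof file (theorems only; no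
definitions, no named facts) toward the named fact
`Literature.NumberTheory.EllipticCurves.ModularForms.eichlerShimuraConstruction`
(`EichlerShimuraConstruction.lean`, [cite: Knapp1993, Thm. 11.74 and Thm. 12.8]).

Main results:

* `congruenceRelation_cofinite_of_int` — **the Eichler–Shimura congruence relation for
  `ℂ/Λ_f`, cofinite form, unconditionally**: for a newform `f ∈ S₂(Γ₀(N))` with integral Fourier
  coefficients, a period pair `L` spanning the period lattice `Λ_f` and `a₄, a₆ ∈ ℚ` with
  `g₂(L) = −4a₄`, `g₃(L) = −4a₆`, `a_p(f)` equals the `p`-th coefficient of `L(E, s)`,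
  `E : y² = x³ + a₄x + a₆`, for all but finitely many primes `p` (Shimura Thm. 7.14–7.15 at almost
  all `p`; Knapp Thm. 11.74 (e)).
* `eichlerShimuraConstruction_of_exists_isNewformOf` — **the named fact, granted modularity**:
  `exists_isNewformOf → eichlerShimuraConstruction`, by the tree's reduction
  `eichlerShimuraConstruction_of_congruenceRelation_cofinite` (`EichlerShimuraConstructionCongruenceProofs`).

## The proof (Honda, J. Math. Soc. Japan 22 (1970), §6.2, Thm. 9 — no reduction of `X₀(N)` mod `p`)

For almost all `p` (the finitely many exceptions are collected in one modulus `M`):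
1. *Modular side (tree):* `ℓ_f = Σ aₙqⁿ/n = log_E(z(q))` for a `z ∈ ℚ⟦q⟧` with bounded
   denominators (`IsXPresentation.exists_formalLog_subst_eq`, `exists_int_series_of_mul_yFn_eq` of
   `ModularParam{FormalLog,Integrality}Proofs`), descended to `ℚ` (`exists_rat_series_formalLog_subst_eq`)
   and `p`-integral for `p ∤ c` (`exists_int_isPadicInt_of_mul_eq`); `ℓ_f` is of Honda type
   `p − a_p(f)T + T²` by the Hecke recursion (`HondaTypeTransport.norm_coeff_hondaShift_mk_div_le_one`,
   `IsNewform0.cuspCoeff_prime_mul`).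
2. *Elliptic side:* for a global minimal model `E' = vc • E` (`hasGlobalMinimalModel_rat_holds`) and
   good odd `p`, `log_{E'}` is of type `p − a_p(E')T + T²`, `a_p(E') = p + 1 − #Ẽ'(𝔽_p)`
   (`FormalGroupFrobeniusTypeProofs.norm_coeff_hondaShift_formalLog_le_one`: `π² − a_pπ + p = 0` on the
   formal group), hence so is `log_E(z) = u⁻¹·log_{E'}(θ_vc(z))` (`formalLog_variableChange_subst`,
   Honda's transport lemma `norm_coeff_hondaShift_subst_le_one`, `u ∈ ℤ_pˣ`):
   `norm_coeff_hondaShift_formalLog_subst_of_variableChange`.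
3. *Uniqueness of the type* along the Euler recursion (`HondaTypeUniqueness.eq_of_hondaShift_of_recursion`):
   `a_p(f) = a_p(E')` (`int_eq_of_hondaShift_intSeq`), and `a_p(E') = L(E, s)_p`
   (`LFunction_apply_prime_eq_frobeniusTrace`, `LFunction_smul`).

Relation to `ModularParametrizationCongruenceHondaProofs` (landed in parallel): that file runs
Honda's method for the newform of a *given* elliptic curve `W/ℚ`, reading the type only modulo `p`
(`c_{p-1}(ω) ≡ a_p (mod p)`) and closing the gap with Hasse's bound for `W`; here the type of
`log_{E'}` is determined *exactly* (`π² − a_pπ + p = 0` on the formal group over `𝔽_p⸨X⸩`), so no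
curve `W` and no bound on `a_p(f)` is needed and the congruence holds for every newform with
integral coefficients — which is the form `eichlerShimuraConstruction` requires.

## References

* T. Honda, *On the theory of commutative formal groups*, J. Math. Soc. Japan 22 (1970), 213–246,
  §6.2, Thm. 9. [Honda1970]
* G. Shimura, *Introduction to the Arithmetic Theory of Automorphic Functions* (1971), Thm. 7.14,
  Thm. 7.15. [cite: ShimuraIATAF1971, Thm. 7.14]
* A. W. Knapp, *Elliptic Curves* (1992), Thm. 11.74 with Remarks (PDF p. 287), Thm. 12.8 (PDF p. 301).
  [cite: Knapp1993, Thm. 11.74]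
-/

noncomputable section

open scoped Classical

/-! ## The type of `log_E` over `ℚ_p` for a globally minimal `E/ℚ` at a good odd prime -/

namespace WeierstrassCurve

open PowerSeries Literature.RingTheory.FormalGroups Literature.NumberTheory.EllipticCurves

variable {p : ℕ} [hp : Fact p.Prime]

/-- `ℤ → ℤ_p → 𝔽_p` is the canonical map. [folklore] -/
theorem _root_.Literature.NumberTheory.EllipticCurves.HondaCongruence.toZMod_comp_intCast : (PadicInt.toZMod (p := p)).comp (Int.castRingHom ℤ_[p]) = Int.castRingHom (ZMod p) :=
  RingHom.ext_int _ _

/-- `ℤ → ℤ_p → ℚ_p` is `ℤ → ℚ → ℚ_p`. [folklore] -/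
theorem _root_.Literature.NumberTheory.EllipticCurves.HondaCongruence.coe_comp_intCast :
    (PadicInt.Coe.ringHom (p := p)).comp (Int.castRingHom ℤ_[p]) = (algebraMap ℚ ℚ_[p]).comp (Int.castRingHom ℚ) :=
  RingHom.ext_int _ _

/-- The `ℤ_p`-model of a globally minimal equation base-changes to `W ⊗ ℚ_p`. [folklore] -/
theorem map_coe_integralModelInt (W : WeierstrassCurve ℚ) [W.IsGloballyMinimal] :
    ((integralModelInt W).map (Int.castRingHom ℤ_[p])).map PadicInt.Coe.ringHom = W.map (algebraMap ℚ ℚ_[p]) := by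
  rw [map_map, Literature.NumberTheory.EllipticCurves.HondaCongruence.coe_comp_intCast, ← map_map, map_integralModelInt]

/-- … and reduces to the reduction mod `p` of the integral model. [folklore] -/
theorem map_toZMod_integralModelInt (W : WeierstrassCurve ℚ) [W.IsGloballyMinimal] :
    ((integralModelInt W).map (Int.castRingHom ℤ_[p])).map PadicInt.toZMod =
      (integralModelInt W).map (Int.castRingHom (ZMod p)) := by
  rw [map_map, Literature.NumberTheory.EllipticCurves.HondaCongruence.toZMod_comp_intCast]

/-- **Manin's `a` is the trace of Frobenius** `p + 1 − #Ẽ(𝔽_p)` of the tree (`frobeniusTrace`).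
[folklore] -/
theorem tr_eq_frobeniusTrace (W : WeierstrassCurve ℚ) [W.IsGloballyMinimal] {E : WeierstrassCurve (ZMod p)}
    [E.IsElliptic] (hE : E = (integralModelInt W).map (Int.castRingHom (ZMod p))) :
    HasseManin.tr E = W.frobeniusTrace p := by
  subst hE
  rw [HasseManin.tr, ZMod.card, frobeniusTrace, reductionPointCount]

/-- Good reduction at `p ∤ Δ_min`: the reduction of the integral model is elliptic. [folklore] -/
theorem isElliptic_reduction_of_not_dvd (W : WeierstrassCurve ℚ) [W.IsGloballyMinimal]
    (hgood : ¬ (p : ℤ) ∣ minimalDiscriminantInt W) :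
    ((integralModelInt W).map (Int.castRingHom (ZMod p))).IsElliptic := by
  refine ⟨isUnit_iff_ne_zero.mpr ?_⟩
  rw [map_Δ, eq_intCast, Ne, ZMod.intCast_zmod_eq_zero_iff_dvd]
  exact hgood

/-- **The formal logarithm of `E/ℚ_p` read through an integral parameter is of Honda type
`p − a_pT + T²`, `a_p = frobeniusTrace`** (globally minimal `E`, odd good prime `p`):
`norm_coeff_hondaShift_formalLog_le_one` on the `ℤ_p`-model, and Honda's transport lemma (iii).
[Honda 1970, Thm. 9 (proof)] [cite: SilvermanAEC2009, Thm. V.2.3.1(b)] -/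
theorem norm_coeff_hondaShift_subst_formalLog_le_one (hp2 : p ≠ 2) (W : WeierstrassCurve ℚ) [W.IsElliptic]
    [W.IsGloballyMinimal] (hgood : ¬ (p : ℤ) ∣ minimalDiscriminantInt W) {θ : ℚ_[p]⟦X⟧}
    (hθ0 : constantCoeff θ = 0) (hθ : ∀ n, ‖coeff n θ‖ ≤ 1) (n : ℕ) :
    ‖coeff n (hondaShift p (W.frobeniusTrace p : ℚ_[p]) ((W.map (algebraMap ℚ ℚ_[p])).formalLog.subst θ))‖ ≤ 1 := by
  set V : WeierstrassCurve ℤ_[p] := (integralModelInt W).map (Int.castRingHom ℤ_[p]) with hV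
  have hVc : V.map PadicInt.Coe.ringHom = W.map (algebraMap ℚ ℚ_[p]) := map_coe_integralModelInt W
  have hVt : V.map PadicInt.toZMod = (integralModelInt W).map (Int.castRingHom (ZMod p)) :=
    map_toZMod_integralModelInt W
  haveI hEc : (V.map PadicInt.Coe.ringHom).IsElliptic := by rw [hVc]; infer_instance
  haveI hEt' := isElliptic_reduction_of_not_dvd (p := p) W hgood
  haveI hEt : (V.map PadicInt.toZMod).IsElliptic := by rw [hVt]; infer_instance
  have htr : HasseManin.tr (V.map PadicInt.toZMod) = W.frobeniusTrace p := tr_eq_frobeniusTrace W hVt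
  have H2 := V.norm_coeff_hondaShift_formalLog_le_one hp2
  rw [htr] at H2
  have H2' : ∀ m, ‖coeff m (hondaShift p (W.frobeniusTrace p : ℚ_[p]) (W.map (algebraMap ℚ ℚ_[p])).formalLog)‖ ≤ 1 := by
    intro m
    have h := H2 m
    rwa [hVc] at h
  exact norm_coeff_hondaShift_subst_le_one (Padic.norm_int_le_one _) H2' hθ0 hθ n

end WeierstrassCurve

/-! ## Transport of the type along a `p`-integral change of variables -/

namespace WeierstrassCurve

open PowerSeries Literature.RingTheory.FormalGroups Literature.NumberTheory.EllipticCurves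

variable {p : ℕ} [hp : Fact p.Prime]

/-- The type is insensitive to a `p`-adic unit factor. [folklore] -/
theorem _root_.Literature.NumberTheory.EllipticCurves.HondaCongruence.norm_coeff_hondaShift_of_C_mul
    {a c : ℚ_[p]} (hc : ‖c‖ = 1) {ℓ : ℚ_[p]⟦X⟧} (h : ∀ n, ‖coeff n (hondaShift p a (C c * ℓ))‖ ≤ 1) (n : ℕ) :
    ‖coeff n (hondaShift p a ℓ)‖ ≤ 1 := by
  have h' := h n
  rwa [hondaShift_C_mul, coeff_C_mul, norm_mul, hc, one_mul] at h'

/-- **The type of `log_{W₀} ∘ z` for a (possibly non-minimal) `p`-integral model `W₀`**: if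
`C • W₀` is globally minimal with good reduction at the odd prime `p`, `C = (u, r, s, t)` is
`p`-integral with `u ∈ ℤ_pˣ`, and `z ∈ Xℤ_p⟦X⟧`, then `log_{W₀ ⊗ ℚ_p}(z)` is of Honda type
`p − a_pT + T²`, `a_p = frobeniusTrace (C • W₀) p` — by `norm_coeff_hondaShift_subst_formalLog_le_one`
for `C • W₀` and the parameter `θ_C(z)` (`θ_C : Ŵ₀ ⥲ (C • W₀)^`, `log' ∘ θ_C = u · log`,
`formalLog_variableChange_subst`), and `u ∈ ℤ_pˣ`. [Honda 1970, Thm. 9 (proof)] [folklore] -/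
theorem norm_coeff_hondaShift_formalLog_subst_of_variableChange (hp2 : p ≠ 2) (W₀ : WeierstrassCurve ℚ)
    [W₀.IsElliptic] (vc : VariableChange ℚ) [(vc • W₀).IsGloballyMinimal]
    (hgood : ¬ (p : ℤ) ∣ minimalDiscriminantInt (vc • W₀))
    (h₁ : ‖(W₀.a₁ : ℚ_[p])‖ ≤ 1) (h₂ : ‖(W₀.a₂ : ℚ_[p])‖ ≤ 1) (h₃ : ‖(W₀.a₃ : ℚ_[p])‖ ≤ 1)
    (h₄ : ‖(W₀.a₄ : ℚ_[p])‖ ≤ 1) (h₆ : ‖(W₀.a₆ : ℚ_[p])‖ ≤ 1)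
    (hu : ‖((vc.u : ℚ) : ℚ_[p])‖ = 1) (hr : ‖(vc.r : ℚ_[p])‖ ≤ 1) (hs : ‖(vc.s : ℚ_[p])‖ ≤ 1)
    (ht : ‖(vc.t : ℚ_[p])‖ ≤ 1) {z : ℚ_[p]⟦X⟧} (hz0 : constantCoeff z = 0) (hz : ∀ n, ‖coeff n z‖ ≤ 1) (n : ℕ) :
    ‖coeff n (hondaShift p ((vc • W₀).frobeniusTrace p : ℚ_[p])
      ((W₀.map (algebraMap ℚ ℚ_[p])).formalLog.subst z))‖ ≤ 1 := by
  set φ := algebraMap ℚ ℚ_[p] with hφ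
  set W₀p := W₀.map φ with hW₀p
  set Cp := vc.map (φ : ℚ →+* ℚ_[p]) with hCp
  haveI : W₀p.IsIntegral ℤ_[p] :=
    isIntegral_of_mem_subring W₀p (((PadicInt.mem_subring_iff (p := p)).mpr h₁)) (((PadicInt.mem_subring_iff (p := p)).mpr h₂))
      (((PadicInt.mem_subring_iff (p := p)).mpr h₃)) (((PadicInt.mem_subring_iff (p := p)).mpr h₄)) (((PadicInt.mem_subring_iff (p := p)).mpr h₆))
  have hmap : (vc • W₀).map φ = Cp • W₀p := by rw [hCp, hW₀p, map_variableChange]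
  -- the parameter `θ_C(z)` of `C • W₀`
  set θ := W₀p.formalVariableChange Cp with hθ
  have hθi : IsPadicInt θ := by
    refine W₀p.isPadicInt_formalVariableChange Cp (le_of_eq ?_) ?_ ?_ ?_
    · simpa [hCp, VariableChange.map] using hu
    · simpa [hCp, VariableChange.map] using hr
    · simpa [hCp, VariableChange.map] using hs
    · simpa [hCp, VariableChange.map] using ht
  have hzs : HasSubst z := HasSubst.of_constantCoeff_zero' hz0
  have hθz0 : constantCoeff (θ.subst z) = 0 :=
    (Literature.RingTheory.FormalGroups.constantCoeff_subst_of_constantCoeff_eq_zero hz0 _).trans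
      (W₀p.constantCoeff_formalVariableChange Cp)
  have hθzi : ∀ m, ‖coeff m (θ.subst z)‖ ≤ 1 :=
    isPadicInt_iff_coeff.mp (hθi.powerSeries_subst (isPadicInt_iff_coeff.mpr hz) hzs)
  have key := norm_coeff_hondaShift_subst_formalLog_le_one hp2 (vc • W₀) hgood hθz0 hθzi
  -- `log_{C•W₀}(θ(z)) = u · log_{W₀}(z)`
  have hlog : ((vc • W₀).map φ).formalLog.subst (θ.subst z) = C ((Cp.u : ℚ_[p])) * (W₀p.formalLog.subst z) := by
    rw [hmap, hθ, ← subst_comp_subst_apply (W₀p.hasSubst_formalVariableChange Cp) hzs,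
      W₀p.formalLog_variableChange_subst Cp, subst_mul hzs, Literature.NumberTheory.EllipticCurves.C_subst]
  have key' : ∀ m, ‖coeff m (hondaShift p ((vc • W₀).frobeniusTrace p : ℚ_[p])
      (C ((Cp.u : ℚ_[p])) * (W₀p.formalLog.subst z)))‖ ≤ 1 := fun m => by
    have h := key m
    rwa [hlog] at h
  have hu' : ‖((Cp.u : ℚ_[p]))‖ = 1 := by simpa [hCp, VariableChange.map] using hu
  exact Literature.NumberTheory.EllipticCurves.HondaCongruence.norm_coeff_hondaShift_of_C_mul hu' key' n

end WeierstrassCurve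

section PieceA
open PowerSeries Literature.NumberTheory.EllipticCurves

namespace Literature.NumberTheory.EllipticCurves.HondaCongruence

/-- **Bounded denominators ⇒ `p`-integrality for almost all `p`.** If `z ∈ ℚ⟦X⟧` satisfies
`z · Q = P` with `P, Q ∈ ℤ⟦X⟧`, `Q ≠ 0`, then there is an integer `c ≠ 0` (the lowest nonzero
coefficient of `Q`) such that `z` has `p`-integral coefficients for every prime `p ∤ c`.
[Honda 1970, §6.2, p. 241] [folklore] -/
theorem exists_int_isPadicInt_of_mul_eq {z : ℚ⟦X⟧} {P Q : ℤ⟦X⟧} (hQ : Q ≠ 0)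
    (h : z * Q.map (Int.castRingHom ℚ) = P.map (Int.castRingHom ℚ)) :
    ∃ c : ℤ, c ≠ 0 ∧ ∀ (p : ℕ) [Fact p.Prime], ¬ (p : ℤ) ∣ c →
      IsPadicInt (z.map (algebraMap ℚ ℚ_[p])) := by
  set Qq : ℚ⟦X⟧ := Q.map (Int.castRingHom ℚ) with hQq
  set Pq : ℚ⟦X⟧ := P.map (Int.castRingHom ℚ) with hPq
  have hinj : Function.Injective (PowerSeries.map (Int.castRingHom ℚ)) :=
    PowerSeries.map_injective _ Int.cast_injective
  have hQq0 : Qq ≠ 0 := fun h0 => hQ (hinj (by rw [← hQq, h0, map_zero]))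
  set m := Qq.order.toNat with hm
  refine ⟨coeff m Q, ?_, fun p _ hpc => ?_⟩
  · intro hc
    apply constantCoeff_divXPowOrder_eq_zero_iff.not.mpr hQq0
    rw [constantCoeff_divXPowOrder, ← hm, hQq, coeff_map, hc, map_zero]
  -- over `ℚ_p`
  set φ := algebraMap ℚ ℚ_[p] with hφ
  have hc1 : ‖((coeff m Q : ℤ) : ℚ_[p])‖ = 1 :=
    le_antisymm (Padic.norm_int_le_one _)
      (not_lt.mp fun hlt => hpc (Padic.norm_intCast_lt_one_iff.mp hlt))
  have hc0 : ((coeff m Q : ℤ) : ℚ_[p]) ≠ 0 := fun h0 => by rw [h0, norm_zero] at hc1; exact zero_ne_one hc1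
  have hdiv : divXPowOrder z * divXPowOrder Qq = divXPowOrder Pq := by
    rw [← divXPowOrder_mul, h]
  set Q₁ : ℚ_[p]⟦X⟧ := (divXPowOrder Qq).map φ with hQ₁
  set P₁ : ℚ_[p]⟦X⟧ := (divXPowOrder Pq).map φ with hP₁
  set z₁ : ℚ_[p]⟦X⟧ := (divXPowOrder z).map φ with hz₁
  have hmapZ : ∀ (F : ℤ⟦X⟧) (n : ℕ), coeff n ((divXPowOrder (F.map (Int.castRingHom ℚ))).map φ) =
      ((coeff (n + (F.map (Int.castRingHom ℚ)).order.toNat) F : ℤ) : ℚ_[p]) := fun F n => by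
    rw [coeff_map, coeff_divXPowOrder, coeff_map, eq_intCast, hφ, map_intCast]
  have hQ₁i : IsPadicInt Q₁ := isPadicInt_iff_coeff.mpr fun n => by
    rw [hQ₁, hQq, hmapZ]; exact Padic.norm_int_le_one _
  have hP₁i : IsPadicInt P₁ := isPadicInt_iff_coeff.mpr fun n => by
    rw [hP₁, hPq, hmapZ]; exact Padic.norm_int_le_one _
  have hQ₁c : constantCoeff Q₁ = ((coeff m Q : ℤ) : ℚ_[p]) := by
    rw [← coeff_zero_eq_constantCoeff_apply, hQ₁, hQq, hmapZ, zero_add]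
  -- normalise the constant term and invert
  set Q₂ : ℚ_[p]⟦X⟧ := C (((coeff m Q : ℤ) : ℚ_[p])⁻¹) * Q₁ with hQ₂
  have hQ₂c : constantCoeff Q₂ = 1 := by
    rw [hQ₂, map_mul, constantCoeff_C, hQ₁c, inv_mul_cancel₀ hc0]
  have hQ₂i : IsPadicInt Q₂ :=
    (IsPadicInt.powerSeries_C (by rw [norm_inv, hc1, inv_one])).mul hQ₁i
  have hinv : IsPadicInt (Q₂.invOfUnit 1) := hQ₂i.invOfUnit_one hQ₂c
  have hQ₂inv : Q₂ * Q₂.invOfUnit 1 = 1 := PowerSeries.mul_invOfUnit Q₂ 1 (by rw [hQ₂c, Units.val_one])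
  have hz₁e : z₁ = P₁ * C (((coeff m Q : ℤ) : ℚ_[p])⁻¹) * Q₂.invOfUnit 1 := by
    have hzQ : z₁ * Q₁ = P₁ := by rw [hz₁, hQ₁, hP₁, ← map_mul, hdiv]
    calc z₁ = z₁ * (Q₂ * Q₂.invOfUnit 1) := by rw [hQ₂inv, mul_one]
      _ = (z₁ * Q₁) * C (((coeff m Q : ℤ) : ℚ_[p])⁻¹) * Q₂.invOfUnit 1 := by rw [hQ₂]; ring
      _ = _ := by rw [hzQ]
  have hz₁i : IsPadicInt z₁ := by
    rw [hz₁e]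
    exact (hP₁i.mul (IsPadicInt.powerSeries_C (by rw [norm_inv, hc1, inv_one]))).mul hinv
  -- `z = X^k · z₁`
  have hz : z.map φ = (X : ℚ_[p]⟦X⟧) ^ z.order.toNat * z₁ := by
    rw [hz₁, ← PowerSeries.map_X φ, ← map_pow, ← map_mul, X_pow_order_mul_divXPowOrder]
  rw [hz]
  exact (IsPadicInt.powerSeries_X.pow _).mul hz₁i

end Literature.NumberTheory.EllipticCurves.HondaCongruence

end PieceA

/-! ## Two Honda types for `Σ aₙ Xⁿ/n` with the Hecke recursion force `a_p = b` -/

namespace Literature.NumberTheory.EllipticCurves.HondaCongruence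

open PowerSeries Literature.RingTheory.FormalGroups

variable {p : ℕ} [hp : Fact p.Prime]

/-- **Reading off `a_p` exactly.** If an integer sequence `(aₙ)` with `a₀ = 0`, `a₁ = 1` satisfies
the Hecke recursion `a_{pn} = a_p aₙ − p a_{n/p}` (`n ≥ 1`), and `ℓ = Σ aₙXⁿ/n` is ALSO of Honda
type `p − bT + T²` for an integer `b`, then `b = a_p`: `ℓ` is of type `p − a_pT + T²`
(`norm_coeff_hondaShift_mk_div_le_one`) and the type is unique along the Euler recursion
(`eq_of_hondaShift_of_recursion`). [Honda 1970, Thm. 8 + proof of Thm. 9] [folklore] -/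
theorem int_eq_of_hondaShift_intSeq {a : ℕ → ℤ} (ha0 : a 0 = 0) (ha1 : a 1 = 1)
    (hrec : ∀ n, 0 < n → a (p * n) = a p * a n - p * (if p ∣ n then a (n / p) else 0))
    {b : ℤ} (hb : ∀ n, ‖coeff n (hondaShift p (b : ℚ_[p]) (PowerSeries.mk fun k ↦ ((a k : ℤ) : ℚ_[p]) / k))‖ ≤ 1) :
    b = a p := by
  set aq : ℕ → ℚ_[p] := fun k => ((a k : ℤ) : ℚ_[p]) with haq
  have hint : ∀ n, ‖aq n‖ ≤ 1 := fun n => Padic.norm_int_le_one _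
  have hrecq : ∀ n, 0 < n → aq (p * n) = aq p * aq n - p * (if p ∣ n then aq (n / p) else 0) := by
    intro n hn
    simp only [haq]
    rw [hrec n hn]
    push_cast
    split_ifs <;> simp
  have hrec' : ∀ k, aq (p ^ (k + 2)) = aq p * aq (p ^ (k + 1)) - p * aq (p ^ k) := by
    intro k
    have h := hrecq (p ^ (k + 1)) (pow_pos hp.out.pos _)
    have hdiv : p ^ (k + 1) / p = p ^ k := by
      rw [pow_succ, Nat.mul_div_cancel _ hp.out.pos]
    rw [← pow_succ', if_pos (dvd_pow_self p (Nat.succ_ne_zero k)), hdiv] at h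
    rw [show k + 2 = k + 1 + 1 from rfl, h]
  have hbp := norm_coeff_hondaShift_mk_div_le_one aq (by simp [haq, ha0]) hrecq hint
  have h1 : aq 1 = 1 := by simp [haq, ha1]
  have h2 := eq_of_hondaShift_of_recursion h1 hint hrec' hb hbp
  simp only [haq] at h2
  exact_mod_cast h2

end Literature.NumberTheory.EllipticCurves.HondaCongruence

section PieceE
open PowerSeries Literature.NumberTheory.EllipticCurves
open Literature.NumberTheory.EllipticCurves.ModularForms CongruenceSubgroup
open scoped ModularForm MatrixGroups

namespace Literature.NumberTheory.EllipticCurves.HondaCongruence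

/-- **The modular parametrisation at `∞` in formal terms (Honda's input).** For a nonzero
`f ∈ S₂(Γ₀(N))` with integral coefficients `aₙ`, a period pair `L` with `Λ(L) ⊇ Λ_f` and
`g₂(L) = −4a₄`, `g₃(L) = −4a₆`, `a₄, a₆ ∈ ℚ`, there is `z ∈ ℚ⟦q⟧` with `z(0) = 0`,
**`log_E(z) = Σ aₙ qⁿ/n`** for `E : y² = x³ + a₄x + a₆` over `ℚ`, and `z·Q = P` for some
`P, Q ∈ ℤ⟦q⟧`, `Q ≠ 0` (bounded denominators) — the tree's
`IsXPresentation.exists_formalLog_subst_eq` (over `ℂ`) and `exists_int_series_of_mul_yFn_eq`,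
descended to `ℚ` coefficientwise. [Honda 1970, §6.2 (6.8)–(6.9)] [cite: ShimuraIATAF1971, Thm. 7.14] -/
theorem exists_rat_series_formalLog_subst_eq {N : ℕ} [NeZero N] (f : CuspForm (Gamma0 N) 2) (hf : f ≠ 0)
    (a : ℕ → ℤ) (ha : ∀ n, (a n : ℂ) = cuspCoeff f n) (L : PeriodPair)
    (hΛ : ∀ x ∈ periodLattice f, x ∈ L.lattice) (a₄ a₆ : ℚ) (h₂ : L.g₂ = -4 * (a₄ : ℂ))
    (h₃ : L.g₃ = -4 * (a₆ : ℂ)) :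
    ∃ (z : ℚ⟦X⟧) (P Q : ℤ⟦X⟧), constantCoeff z = 0 ∧ Q ≠ 0 ∧
      z * Q.map (Int.castRingHom ℚ) = P.map (Int.castRingHom ℚ) ∧
      ({ a₁ := 0, a₂ := 0, a₃ := 0, a₄ := a₄, a₆ := a₆ } : WeierstrassCurve ℚ).formalLog.subst z =
        PowerSeries.mk fun n ↦ (a n : ℚ) / n := by
  obtain ⟨k, F, G, hk, hX⟩ := exists_isXPresentation f hf L hΛ
  obtain ⟨zc, hzc0, hzy, hlog⟩ := hX.exists_formalLog_subst_eq hf h₂ h₃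
  have hint : ∀ n, ∃ m : ℤ, (m : ℂ) = cuspCoeff f n := fun n => ⟨a n, ha n⟩
  obtain ⟨z, P, Q, hz, hQ, hPQ⟩ := hX.exists_int_series_of_mul_yFn_eq hf (by omega) hint
    ⟨-4 * a₄, by push_cast; exact h₂.symm⟩ ⟨-4 * a₆, by push_cast; exact h₃.symm⟩ hzy
  refine ⟨z, P, Q, ?_, hQ, hPQ, ?_⟩
  · have h0 := hzc0
    rw [← hz, ← coeff_zero_eq_constantCoeff, coeff_map, coeff_zero_eq_constantCoeff] at h0
    exact (map_eq_zero (algebraMap ℚ ℂ)).mp h0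
  · apply PowerSeries.map_injective (algebraMap ℚ ℂ) (algebraMap ℚ ℂ).injective
    set W₀ : WeierstrassCurve ℚ := { a₁ := 0, a₂ := 0, a₃ := 0, a₄ := a₄, a₆ := a₆ } with hW₀
    have hmapW : W₀.map (algebraMap ℚ ℂ) = ({ a₁ := 0, a₂ := 0, a₃ := 0, a₄ := (a₄ : ℂ), a₆ := (a₆ : ℂ) } :
        WeierstrassCurve ℂ) := by
      simp [hW₀, WeierstrassCurve.map]
    have hzs : HasSubst z := by
      refine HasSubst.of_constantCoeff_zero' ?_
      have h0 := hzc0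
      rw [← hz, ← coeff_zero_eq_constantCoeff, coeff_map, coeff_zero_eq_constantCoeff] at h0
      exact (map_eq_zero (algebraMap ℚ ℂ)).mp h0
    rw [powerSeries_map_subst hzs (algebraMap ℚ ℂ), W₀.map_formalLog (algebraMap ℚ ℂ), hmapW, hz, hlog]
    ext n
    rw [coeff_map, coeff_mk, coeff_mk, map_div₀, map_natCast, eq_ratCast, Rat.cast_intCast, ha]

end Literature.NumberTheory.EllipticCurves.HondaCongruence

end PieceE

/-! ## The cofinite Eichler–Shimura congruence for `ℂ/Λ_f`, and the fact modulo modularity -/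

namespace Literature.NumberTheory.EllipticCurves.ModularForms

open PowerSeries Literature.RingTheory.FormalGroups Literature.NumberTheory.EllipticCurves
open Literature.NumberTheory.EllipticCurves.HondaCongruence
open scoped MatrixGroups ModularForm
open CongruenceSubgroup

/-- A nonzero rational with numerator and denominator prime to `p` is a `p`-adic unit. [folklore] -/
theorem _root_.Literature.NumberTheory.EllipticCurves.HondaCongruence.norm_ratCast_eq_one {p : ℕ}
    [Fact p.Prime] {q : ℚ} (hn : ¬ (p : ℤ) ∣ q.num) (hd : ¬ (p : ℤ) ∣ (q.den : ℤ)) : ‖(q : ℚ_[p])‖ = 1 := by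
  have hnum : ‖((q.num : ℤ) : ℚ_[p])‖ = 1 :=
    le_antisymm (Padic.norm_int_le_one _) (not_lt.mp fun h => hn (Padic.norm_intCast_lt_one_iff.mp h))
  have hden : ‖((q.den : ℤ) : ℚ_[p])‖ = 1 :=
    le_antisymm (Padic.norm_int_le_one _) (not_lt.mp fun h => hd (Padic.norm_intCast_lt_one_iff.mp h))
  have hq : (q : ℚ_[p]) = ((q.num : ℤ) : ℚ_[p]) / ((q.den : ℤ) : ℚ_[p]) := by
    rw [Int.cast_natCast, ← Rat.cast_intCast, ← Rat.cast_natCast, ← Rat.cast_div, Rat.num_div_den]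
  rw [hq, norm_div, hnum, hden, div_one]

/-- A rational with denominator prime to `p` is `p`-integral. [folklore] -/
theorem _root_.Literature.NumberTheory.EllipticCurves.HondaCongruence.norm_ratCast_le_one {p : ℕ}
    [Fact p.Prime] {q : ℚ} (hd : ¬ (p : ℤ) ∣ (q.den : ℤ)) : ‖(q : ℚ_[p])‖ ≤ 1 :=
  Padic.norm_rat_le_one fun h => hd (Int.natCast_dvd_natCast.mpr h)

variable {N : ℕ} [NeZero N]

/-- **The Eichler–Shimura congruence relation for `E_f = ℂ/Λ_f`, cofinite form (Honda's proof).**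
For a newform `f ∈ S₂(Γ₀(N))` with integral Fourier coefficients, a period pair `L` spanning the
period lattice `Λ_f`, and `a₄, a₆ ∈ ℚ` with `g₂(L) = −4a₄`, `g₃(L) = −4a₆`, one has
`a_p(f) = a_p(E)` for all but finitely many primes `p`, `E : y² = x³ + a₄x + a₆`
(`a_p(E)` = the `p`-th coefficient of Mathlib's `L(E, s)`). Proof (Honda 1970, §6.2, Thm. 9, with
the cruder integrality of `ModularParamIntegralityProofs` in place of the model of `X₀(N)`): for
almost all `p`, `ℓ_f = Σ aₙqⁿ/n = log_E(z(q))` with `z ∈ qℤ_p⟦q⟧` (`exists_rat_series_formalLog_subst_eq`,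
`exists_int_isPadicInt_of_mul_eq`); `ℓ_f` is of Honda type `p − a_p(f)T + T²` (Hecke) and of type
`p − a_p(E)T + T²` (`norm_coeff_hondaShift_formalLog_subst_of_variableChange`: Frobenius on the
formal group of a global minimal model, `π² − a_p(E)π + p = 0`); the type is unique
(`int_eq_of_hondaShift_intSeq`), and `a_p(E) = L(E,s)_p` (`LFunction_apply_prime_eq_frobeniusTrace`,
`LFunction_smul`). [Honda 1970, Thm. 9] [cite: ShimuraIATAF1971, Thm. 7.14–7.15]
[cite: Knapp1993, Thm. 11.74 with Remarks (PDF p. 287)] -/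
theorem congruenceRelation_cofinite_of_int (f : CuspForm (Gamma0 N) 2) (hf : IsNewform0 f)
    (hint : ∀ n, ∃ m : ℤ, (m : ℂ) = cuspCoeff f n) (L : PeriodPair)
    (hL : L.lattice.toAddSubgroup = periodLattice f) (a₄ a₆ : ℚ) (h₂ : L.g₂ = -4 * (a₄ : ℂ))
    (h₃ : L.g₃ = -4 * (a₆ : ℂ)) :
    {p : ℕ | p.Prime ∧ cuspCoeff f p ≠
      (({ a₁ := 0, a₂ := 0, a₃ := 0, a₄ := a₄, a₆ := a₆ } : WeierstrassCurve ℚ).LFunction p : ℂ)}.Finite := by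
  classical
  set W₀ : WeierstrassCurve ℚ := { a₁ := 0, a₂ := 0, a₃ := 0, a₄ := a₄, a₆ := a₆ } with hW₀
  haveI hW₀e : W₀.IsElliptic := isElliptic_shortModel h₂ h₃
  -- the integer coefficients
  choose a ha using hint
  have hf0 : f ≠ 0 := hf.ne_zero
  have hΛ : ∀ x ∈ periodLattice f, x ∈ L.lattice := fun x hx => by
    have : x ∈ L.lattice.toAddSubgroup := hL ▸ hx
    exact this
  -- the modular input and its bounded denominators
  obtain ⟨z, P, Q, hz0, hQ, hPQ, hlog⟩ := exists_rat_series_formalLog_subst_eq f hf0 a ha L hΛ a₄ a₆ h₂ h₃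
  obtain ⟨c, hc, hcint⟩ := exists_int_isPadicInt_of_mul_eq hQ hPQ
  -- a global minimal model
  obtain ⟨vc, hmin⟩ := WeierstrassCurve.hasGlobalMinimalModel_rat_holds W₀
  haveI := hmin
  -- the exceptional modulus: the product of the finitely many bad quantities
  have hΔ0 : (vc • W₀).minimalDiscriminantInt ≠ 0 := by
    intro h0
    have h := (vc • W₀).isUnit_Δ
    rw [← WeierstrassCurve.map_integralModelInt (vc • W₀), WeierstrassCurve.map_Δ] at h
    change IsUnit ((Int.castRingHom ℚ) ((vc • W₀).minimalDiscriminantInt)) at h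
    rw [h0, map_zero] at h
    exact not_isUnit_zero h
  have hu0 : (vc.u : ℚ) ≠ 0 := vc.u.ne_zero
  set l : List ℕ := [2, N, ((vc • W₀).minimalDiscriminantInt).natAbs, c.natAbs, a₄.den, a₆.den,
    (vc.u : ℚ).num.natAbs, (vc.u : ℚ).den, vc.r.den, vc.s.den, vc.t.den] with hl
  set M : ℕ := l.prod with hM
  have hM0 : M ≠ 0 := by
    rw [hM, Ne, List.prod_eq_zero_iff, hl]
    simp only [List.mem_cons, List.not_mem_nil, or_false, not_or]
    refine ⟨two_ne_zero.symm, (NeZero.ne N).symm, (Int.natAbs_ne_zero.mpr hΔ0).symm,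
      (Int.natAbs_ne_zero.mpr hc).symm, a₄.den_nz.symm, a₆.den_nz.symm,
      (Int.natAbs_ne_zero.mpr (Rat.num_ne_zero.mpr hu0)).symm, (vc.u : ℚ).den_nz.symm, vc.r.den_nz.symm,
      vc.s.den_nz.symm, vc.t.den_nz.symm⟩
  -- it suffices to treat the primes not dividing `M`
  refine (Set.finite_le_nat M).subset ?_
  rintro p ⟨hp, hne⟩
  by_contra hpM
  apply hne
  have hpM' : ¬ p ∣ M := fun h => hpM (Nat.le_of_dvd (Nat.pos_of_ne_zero hM0) h)
  haveI := Fact.mk hp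
  -- consequences of `p ∤ M`
  have hdvdM : ∀ d : ℕ, d ∈ l → ¬ p ∣ d := fun d hd hpd => hpM' (hpd.trans (List.dvd_prod hd))
  have hmem : ∀ d : ℕ, d ∈ l ↔ d = 2 ∨ d = N ∨ d = ((vc • W₀).minimalDiscriminantInt).natAbs ∨ d = c.natAbs ∨
      d = a₄.den ∨ d = a₆.den ∨ d = (vc.u : ℚ).num.natAbs ∨ d = (vc.u : ℚ).den ∨ d = vc.r.den ∨ d = vc.s.den ∨
      d = vc.t.den := fun d => by
    rw [hl]; simp only [List.mem_cons, List.not_mem_nil, or_false]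
  have hIntDvd : ∀ m : ℤ, m.natAbs ∈ l → ¬ (p : ℤ) ∣ m := fun m hm hpm =>
    hdvdM m.natAbs hm (Int.natCast_dvd_natCast.mp ((Int.dvd_natAbs).mpr hpm))
  have hNatDvd : ∀ d : ℕ, d ∈ l → ¬ (p : ℤ) ∣ (d : ℤ) := fun d hd hpd =>
    hdvdM d hd (Int.natCast_dvd_natCast.mp hpd)
  have hp2 : p ≠ 2 := by
    rintro rfl; exact hdvdM 2 ((hmem 2).mpr (Or.inl rfl)) dvd_rfl
  have hpN : ¬ p ∣ N := hdvdM N ((hmem N).mpr (Or.inr (Or.inl rfl)))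
  have hgood : ¬ (p : ℤ) ∣ (vc • W₀).minimalDiscriminantInt :=
    hIntDvd _ ((hmem _).mpr (Or.inr (Or.inr (Or.inl rfl))))
  have hpc : ¬ (p : ℤ) ∣ c := hIntDvd _ ((hmem _).mpr (Or.inr (Or.inr (Or.inr (Or.inl rfl)))))
  have ha₄ : ‖(a₄ : ℚ_[p])‖ ≤ 1 :=
    norm_ratCast_le_one (hNatDvd _ ((hmem _).mpr (Or.inr (Or.inr (Or.inr (Or.inr (Or.inl rfl)))))))
  have ha₆ : ‖(a₆ : ℚ_[p])‖ ≤ 1 :=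
    norm_ratCast_le_one (hNatDvd _ ((hmem _).mpr (Or.inr (Or.inr (Or.inr (Or.inr (Or.inr (Or.inl rfl))))))))
  have hu : ‖((vc.u : ℚ) : ℚ_[p])‖ = 1 :=
    norm_ratCast_eq_one (hIntDvd _ ((hmem _).mpr (Or.inr (Or.inr (Or.inr (Or.inr (Or.inr (Or.inr (Or.inl rfl)))))))))
      (hNatDvd _ ((hmem _).mpr (Or.inr (Or.inr (Or.inr (Or.inr (Or.inr (Or.inr (Or.inr (Or.inl rfl))))))))))
  have hr : ‖(vc.r : ℚ_[p])‖ ≤ 1 := norm_ratCast_le_one (hNatDvd _ ((hmem _).mpr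
    (Or.inr (Or.inr (Or.inr (Or.inr (Or.inr (Or.inr (Or.inr (Or.inr (Or.inl rfl)))))))))))
  have hs : ‖(vc.s : ℚ_[p])‖ ≤ 1 := norm_ratCast_le_one (hNatDvd _ ((hmem _).mpr
    (Or.inr (Or.inr (Or.inr (Or.inr (Or.inr (Or.inr (Or.inr (Or.inr (Or.inr (Or.inl rfl))))))))))))
  have ht : ‖(vc.t : ℚ_[p])‖ ≤ 1 := norm_ratCast_le_one (hNatDvd _ ((hmem _).mpr
    (Or.inr (Or.inr (Or.inr (Or.inr (Or.inr (Or.inr (Or.inr (Or.inr (Or.inr (Or.inr rfl))))))))))))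
  -- the `p`-adic series
  set φ := algebraMap ℚ ℚ_[p] with hφ
  set zp : ℚ_[p]⟦X⟧ := z.map φ with hzp
  have hzp0 : constantCoeff zp = 0 := by
    rw [hzp, ← coeff_zero_eq_constantCoeff, coeff_map, coeff_zero_eq_constantCoeff, hz0, map_zero]
  have hzpi : ∀ n, ‖coeff n zp‖ ≤ 1 := isPadicInt_iff_coeff.mp (hcint p hpc)
  have hzs : HasSubst z := HasSubst.of_constantCoeff_zero' hz0
  have hℓ : (W₀.map φ).formalLog.subst zp = PowerSeries.mk fun k => ((a k : ℤ) : ℚ_[p]) / k := by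
    rw [hzp, ← W₀.map_formalLog φ, ← powerSeries_map_subst hzs φ, hlog]
    ext n
    rw [coeff_map, coeff_mk, coeff_mk, map_div₀, map_natCast, map_intCast]
  -- type `p − a_p(E) T + T²`
  have hbE : ∀ n, ‖coeff n (hondaShift p ((vc • W₀).frobeniusTrace p : ℚ_[p])
      (PowerSeries.mk fun k => ((a k : ℤ) : ℚ_[p]) / k))‖ ≤ 1 := by
    intro n
    rw [← hℓ]
    exact WeierstrassCurve.norm_coeff_hondaShift_formalLog_subst_of_variableChange hp2 W₀ vc hgood
      (by simp [hW₀]) (by simp [hW₀]) (by simp [hW₀]) (by simpa [hW₀] using ha₄) (by simpa [hW₀] using ha₆)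
      hu hr hs ht hzp0 hzpi n
  -- the Hecke recursion over `ℤ`
  have ha0 : a 0 = 0 := by
    have h := ha 0
    rw [cuspCoeff_zero (one_mem_strictPeriods_gamma0 N) f] at h
    exact_mod_cast h
  have ha1 : a 1 = 1 := by
    have h := ha 1
    rw [show cuspCoeff f 1 = 1 from hf.2.2] at h
    exact_mod_cast h
  have hrec : ∀ n, 0 < n → a (p * n) = a p * a n - p * (if p ∣ n then a (n / p) else 0) := by
    intro n hn
    have h := hf.cuspCoeff_prime_mul hp n
    rw [if_neg hpN, ← ha, ← ha, ← ha, show ((2 : ℤ) - 1) = 1 by norm_num, zpow_one] at h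
    have h' : ((a (p * n) : ℤ) : ℂ) = ((a p * a n - p * (if p ∣ n then a (n / p) else 0) : ℤ) : ℂ) := by
      rw [h]; push_cast; split_ifs with hpn
      · rw [← ha]
      · simp
    exact_mod_cast h'
  have hap : (vc • W₀).frobeniusTrace p = a p := int_eq_of_hondaShift_intSeq ha0 ha1 hrec hbE
  -- the `L`-function coefficient
  have hL' : W₀.LFunction p = (vc • W₀).frobeniusTrace p := by
    rw [← WeierstrassCurve.LFunction_smul W₀ vc]
    exact WeierstrassCurve.LFunction_apply_prime_eq_frobeniusTrace (vc • W₀) p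
      (WeierstrassCurve.hasGoodReductionAtPrime_of_not_dvd _ p hgood)
  rw [hL', hap, ha]

/-- **`eichlerShimuraConstruction` modulo modularity**: granted `exists_isNewformOf` (every
elliptic curve over `ℚ` is attached to some newform, BCDT), the named fact
`eichlerShimuraConstruction` holds — by the reduction
`eichlerShimuraConstruction_of_congruenceRelation_cofinite` (`EichlerShimuraConstructionCongruenceProofs`)
and the now unconditional cofinite congruence relation `congruenceRelation_cofinite_of_int`.
[cite: Knapp1993, Thm. 11.74 (PDF p. 287) and Thm. 12.8 (PDF p. 301)] -/
theorem eichlerShimuraConstruction_of_exists_isNewformOf (h₁ : exists_isNewformOf) : eichlerShimuraConstruction := by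
  intro N _ f hf hint
  have hint' : ∀ n, ∃ m : ℤ, (m : ℂ) = cuspCoeff f n := fun n => (hint n).imp fun m hm => hm.symm
  have hQ : coeffField f = ⊥ := coeffField_eq_bot_of_forall_exists_intCast hint
  obtain ⟨Lf, hLf⟩ := hf.exists_periodPair_of_coeffField_eq_bot hQ
  obtain ⟨a₄, a₆, h₂, h₃⟩ := hf.exists_rat_g₂_g₃_of_lattice_eq_periodLattice hQ Lf hLf
  haveI := isElliptic_shortModel h₂ h₃
  have hW : IsNewformOf
      ({ a₁ := 0, a₂ := 0, a₃ := 0, a₄ := a₄, a₆ := a₆ } : WeierstrassCurve ℚ) f :=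
    (isNewformOf_of_cuspCoeff_prime_eq h₁ hf
      ({ a₁ := 0, a₂ := 0, a₃ := 0, a₄ := a₄, a₆ := a₆ } : WeierstrassCurve ℚ)
      (congruenceRelation_cofinite_of_int f hf hint' Lf hLf a₄ a₆ h₂ h₃)
      fun p hp hpS ↦ not_not.mp fun hne ↦ hpS ⟨hp, hne⟩).1
  refine ⟨_, ‹_›, hW, fun {L} hL ↦ ⟨1, one_ne_zero, fun z hz ↦ ?_⟩⟩
  rw [Int.cast_one, one_mul, hL.lattice_eq (isNeronLatticeOf_shortModel h₂ h₃)]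
  rw [← hLf] at hz
  exact hz

end Literature.NumberTheory.EllipticCurves.ModularForms
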